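import Literature.NumberTheory.Rogawski1990.ArchOrbFamGExtJumpWall02   -- ★ p851192 (F0P3a-p08 (g23)) (B-jc) PART 2: the anisotropic-frame head `hasOneSidedJump_hcTwistedDeriv_orbFamGExt_wall02` and all its kit
import Literature.NumberTheory.Rogawski1990.ArchOrbFamGExtJump         -- ★ p851049 (LH3-p03 (g5)) (B-asm): `archHcJump_orbFamGExt_of_wall02`, `exists_archHcJump_orbFamGExt`, `exists_archHCSpaceG_orbFamGExt`; brings (B-rel)
import HarnessLib

/-!
# (I₃) for the extended genuine orbital families `orbFamGExt ν′ a′` in the NONDEGENERATE diagonal frame (`α_i ≠ 0`, `σ_w(α_i) ∈ ℝ`) — the `hα`-twins of the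
# anisotropic-frame heads of ★ `ArchOrbFamGExtJumpWall02` and ★ `ArchOrbFamGExtJump` (Harish-Chandra's jump relations; Shelstad 1979 §4; Bouaziz 1994 §3.2 (I₃))

Topic `NumberTheory/Rogawski1990`; namespace `Literature.NumberTheory.Rogawski1990`.  THEOREMS ONLY (no `def`, no instance, no notation, no axiom, no named fact, no
`sorry`); kernel lane `--kind proof --supports stmt-HodgeConjecture-24833`.  Cell `pub/hodgecm-mathlib`, crux H413 (`stmt-HodgeConjecture-24833`); N8 ROAD CENSUS v0
(F0P3a-p02 (g22), `F0/P3a/F0P3a-p02/g22/N8-ROAD-CENSUS.v0.F0P3ap02g22.md` fd90e2d340c810dd) §4 CUT B ∕ §5 (1) «`hα`-twins of the L1 closers».  Author LH10-p02 (g8).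

WHY.  The letter L1 of the `stub_N9` leaf (`Cruxes/H413/Lines/F0_P3c_StubN9Direct.lean` v12, `HcOrbitalFamiliesStatement`) and every ★ frame-form closer under it carry the
binder `hanis` («`diag α` is ANISOTROPIC over `L`»), because the closer row `stub_N9` is stated for the anisotropic inner form `G′ = U(H)`.  Inside the proofs `hanis` is read
EXACTLY ONCE, as `hα : ∀ i, α i ≠ 0 := ne_zero_of_diagonal_anisotropic hanis`; every engine below the frame forms is stated for the nondegenerate real diagonal frame
(`hα`, `hreal`).  The QUASI-SPLIT group `G_∞ = U(Φ₃)_∞` of rows 2∕4∕5 (archimedean inner-form transfer `stub_N8`; the `G`-side of the endoscopic matching) is the SAME atlas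
at the ISOTROPIC diagonal frame `β = (½, 1, −½)` (★ `formCongr_quasiSplitFrame_diagonal`), where `hherm` ✓ and `hα` ✓ hold but `hanis` ✗ — so an in-house `G`-side road
imports the L1 theory through these twins (census §2 row 2, §4 CUT B).  This file: the (I₃) chain.  PROOFS = the ★ bodies VERBATIM with the binder `hanis` replaced by
`hα` (the line `have hα := ne_zero_of_diagonal_anisotropic hanis` deleted; nothing else changes) — zero new analysis; statements = the ★ statements token for token but for
that one binder; names = the ★ names + `_of_ne_zero`.
* `hasOneSidedJump_hcTwistedDeriv_orbFamGExt_wall02_of_ne_zero` — twin of ★ `hasOneSidedJump_hcTwistedDeriv_orbFamGExt_wall02` ((B-jc) PART 2, F0P3a-p08 (g23)).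
* `archHcJump_orbFamGExt_of_wall02_of_ne_zero`, `exists_archHcJump_orbFamGExt_of_ne_zero`, `exists_archHCSpaceG_orbFamGExt_of_ne_zero` — twins of ★ (B-asm) (LH3-p03 (g5)).
HONEST LABEL: count-neutral (no leaf, no letter, no books row moves); HC_CM is proved only modulo the 7 printed citations (2 remaining: hLiu418 = `stmt-HodgeConjecture-24832`,
h413 = `stmt-HodgeConjecture-24833`) until rung 0 closes.

## References
* [Shelstad1979] D. Shelstad, *Characters and inner forms of a quasi-split group over ℝ*, Compositio Math. 39 (1979), Lemma 4.3 p. 25, Prop. 4.5 p. 26, Thm. 4.7 p. 31.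
* [Bouaziz1994IntegralesOrbitales] A. Bouaziz, *Intégrales orbitales sur les groupes de Lie réductifs*, Ann. Sci. ÉNS 27 (1994), §3.2 (I₃) p. 580, Thm. 3.2.1 p. 581.
* [Rogawski1990] J. D. Rogawski, *Automorphic Representations of Unitary Groups in Three Variables*, Ann. of Math. Stud. 123 (1990), §8.2 pp. 118–124; §14.2 p. 232.
* [Varadarajan1977] V. S. Varadarajan, *Harmonic Analysis on Real Reductive Groups*, LNM 576 (1977), Part I §1.12.
-/

set_option autoImplicit false

noncomputable section

open MeasureTheory MeasureTheory.Measure NumberField NumberField.InfinitePlace Matrix Complex Set Filter Topology Function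
open scoped MatrixGroups Matrix Real Classical ENNReal NNReal ContDiff Matrix.Norms.Operator
open Literature.NumberTheory.Automorphic Literature.NumberTheory.Automorphic.UnitaryGroup Literature.NumberTheory.Automorphic.ArchCartan
open Literature.NumberTheory.Automorphic.RankOneCasimir Literature.NumberTheory.Automorphic.Shelstad1979.StableOrbitalIntegrals
open Literature.MeasureTheory.Group Literature.Analysis.Calculus
open Literature.NumberTheory.GaloisRepresentations

namespace Literature.NumberTheory.Rogawski1990

/-! ## §1 (B-jc) PART 2 in the nondegenerate frame -/

section MainW02

variable (L : Type) [Field L] [NumberField L] [IsCMField L] (α : Fin 3 → L)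
  [MeasurableSpace ↥(arch (↥(maximalRealSubfield L)) L (IsCMField.complexConj L) 3 (Matrix.diagonal α))] [BorelSpace ↥(arch (↥(maximalRealSubfield L)) L (IsCMField.complexConj L) 3 (Matrix.diagonal α))]
  (ν' : Measure ↥(arch (↥(maximalRealSubfield L)) L (IsCMField.complexConj L) 3 (Matrix.diagonal α))) [ν'.IsHaarMeasure] [ν'.IsMulRightInvariant]

/-- **L1 frame form — NONDEGENERATE-FRAME TWIN of ★ `hasOneSidedJump_hcTwistedDeriv_orbFamGExt_wall02`** (`Literature/NumberTheory/Rogawski1990/ArchOrbFamGExtJumpWall02.lean`): the same statement with the anisotropy binder `hanis` replaced by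
`hα : ∀ i, α i ≠ 0`; proof = the ★ body verbatim (the line `have hα := ne_zero_of_diagonal_anisotropic hanis` deleted). [cite: Shelstad1979, Lemma 4.3 (p. 25), Prop. 4.5 (p. 26)] [cite: Bouaziz1994IntegralesOrbitales, §3.2 (I₃) p. 580] [cite: Rogawski1990, §8.2 pp. 118–124] [cite: Varadarajan1977, I §1.12] -/
theorem hasOneSidedJump_hcTwistedDeriv_orbFamGExt_wall02_of_ne_zero
    (hherm : ((Matrix.diagonal α).map (cmConjRingHom L)).transpose = Matrix.diagonal α)
    (hα : ∀ i, α i ≠ 0)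
    (S' : Finset {w : InfinitePlace L // IsComplex w}) (hS' : ∀ w, w ∈ S' → w ∈ splitChartPlaces L α)
    (w : {w : InfinitePlace L // IsComplex w}) (hw : w ∉ S') (hwsp : w ∈ splitChartPlaces L α) :
    ∃ J : ℂ, ∀ a' : ↥(arch (↥(maximalRealSubfield L)) L (IsCMField.complexConj L) 3 (Matrix.diagonal α)) → ℂ, ArchSmooth L 3 (Matrix.diagonal α) a' →
      ∀ p : {w : InfinitePlace L // IsComplex w} → Fin 3 → ℝ, HcSemireg S' w 0 2 p → ∀ (n : ℕ) (m : Fin n → {w : InfinitePlace L // IsComplex w} × Fin 3),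
        HasOneSidedJump
          (fun ν : ℝ => hcTwistedDeriv S' n (fun r => hcAdaptedVec w 0 2 (m r)) (orbFamGExt L α ν' a' S') (p + ν • hcNrm w 0 2))
          (J * hcCayScalar w 0 m * hcTwistedDeriv (insert w S') n (fun r => hcCayVec w 0 2 (m r)) (orbFamGExt L α ν' a' (insert w S')) (hcCayPt w 0 2 p)) := by
  -- the frame
  have hreal : ∀ (w' : {w : InfinitePlace L // IsComplex w}) (i : Fin 3), (w'.1.embedding (α i)).im = 0 :=
    im_embedding_diagonal_eq_zero L 3 α (complexConj_apply_eq_of_diagonal_frame hherm)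
  -- the standard rank-one carrier `U(J)` and its subgroups
  obtain ⟨J, hJ⟩ : ∃ J : Matrix (Fin 2) (Fin 2) ℂ, J = (StdForm.antidiagonal 2).over ℂ := ⟨_, rfl⟩
  letI : MeasurableSpace ↥(unitaryGroupOfForm (starRingEnd ℂ) J) := borel _
  haveI : BorelSpace ↥(unitaryGroupOfForm (starRingEnd ℂ) J) := ⟨rfl⟩
  haveI : LocallyCompactSpace ↥(unitaryGroupOfForm (starRingEnd ℂ) J) := locallyCompactSpace_unitaryGroupOfForm_complex J
  haveI : SecondCountableTopology ↥(unitaryGroupOfForm (starRingEnd ℂ) J) := secondCountableTopology_unitaryGroupOfForm_complex J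
  letI : MeasurableSpace (↥(unitaryGroupOfForm (starRingEnd ℂ) J) ⧸ torusU (starRingEnd ℂ) J) := borel _
  haveI : BorelSpace (↥(unitaryGroupOfForm (starRingEnd ℂ) J) ⧸ torusU (starRingEnd ℂ) J) := ⟨rfl⟩
  haveI : Fact (0 < 2 * Real.pi) := ⟨Real.two_pi_pos⟩
  have hTUc : IsClosed ((torusU (starRingEnd ℂ) J : Subgroup ↥(unitaryGroupOfForm (starRingEnd ℂ) J)) : Set ↥(unitaryGroupOfForm (starRingEnd ℂ) J)) := LineRing.isClosed_torusU_two _ _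
  have hNc : IsClosed ((unipotentU (starRingEnd ℂ) J : Subgroup ↥(unitaryGroupOfForm (starRingEnd ℂ) J)) : Set ↥(unitaryGroupOfForm (starRingEnd ℂ) J)) := LineRing.isClosed_unipotentU _ _
  haveI : LocallyCompactSpace ↥(torusU (starRingEnd ℂ) J) := hTUc.isClosedEmbedding_subtypeVal.locallyCompactSpace
  haveI : SecondCountableTopology ↥(torusU (starRingEnd ℂ) J) := TopologicalSpace.Subtype.secondCountableTopology _
  haveI : BorelSpace ↥(torusU (starRingEnd ℂ) J) := Subtype.borelSpace _
  haveI : LocallyCompactSpace ↥(unipotentU (starRingEnd ℂ) J) := hNc.isClosedEmbedding_subtypeVal.locallyCompactSpace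
  haveI : SecondCountableTopology ↥(unipotentU (starRingEnd ℂ) J) := TopologicalSpace.Subtype.secondCountableTopology _
  haveI : BorelSpace ↥(unipotentU (starRingEnd ℂ) J) := Subtype.borelSpace _
  -- the SHARED rank-one datum
  obtain ⟨μ₀, hμ₀H, hμ₀R, μ₀', hμ₀'i, hμ₀'f, C₁, C₂, -, hC₂, -, hA0, hlink⟩ := sharedRankOneDatum_exists hJ
  haveI := hμ₀H
  haveI := hμ₀R
  haveI := hμ₀'i
  haveI := hμ₀'f
  have hμ0 : μ₀' ≠ 0 := ne_zero_of_sharedA0 hJ μ₀' hC₂ hA0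
  -- the Iwasawa circle `K₁ = {k_s}`: compact, `U(J) = K₁·B`, Haar measure
  obtain ⟨K₁, hK₁def⟩ : ∃ K₁ : Subgroup ↥(unitaryGroupOfForm (starRingEnd ℂ) J), (K₁ : Set ↥(unitaryGroupOfForm (starRingEnd ℂ) J)) =
      Set.range (fun s : AddCircle (2 * Real.pi) =>
        (⟨archPlaneLiftGL 1 (rotMat s) (det_rotMat s), archPlaneLiftGL_rotMat_mem hJ s⟩ : ↥(unitaryGroupOfForm (starRingEnd ℂ) J))) :=
    ⟨{ carrier := Set.range (fun s : AddCircle (2 * Real.pi) =>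
          (⟨archPlaneLiftGL 1 (rotMat s) (det_rotMat s), archPlaneLiftGL_rotMat_mem hJ s⟩ : ↥(unitaryGroupOfForm (starRingEnd ℂ) J)))
       one_mem' := ⟨0, Subtype.ext archPlaneLiftGL_rotMat_zero⟩
       mul_mem' := by
         rintro _ _ ⟨s, rfl⟩ ⟨t, rfl⟩
         exact ⟨s + t, Subtype.ext (archPlaneLiftGL_rotMat_add s t)⟩
       inv_mem' := by
         rintro _ ⟨s, rfl⟩
         exact ⟨-s, Subtype.ext (by rw [Subgroup.coe_inv]; exact archPlaneLiftGL_rotMat_neg s)⟩ }, rfl⟩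
  have hKmem : ∀ s : AddCircle (2 * Real.pi),
      (⟨archPlaneLiftGL 1 (rotMat s) (det_rotMat s), archPlaneLiftGL_rotMat_mem hJ s⟩ : ↥(unitaryGroupOfForm (starRingEnd ℂ) J)) ∈ K₁ := fun s => by
    rw [← SetLike.mem_coe, hK₁def]; exact ⟨s, rfl⟩
  have hKmem' : ∀ k ∈ K₁, ∃ s : AddCircle (2 * Real.pi),
      k = (⟨archPlaneLiftGL 1 (rotMat s) (det_rotMat s), archPlaneLiftGL_rotMat_mem hJ s⟩ : ↥(unitaryGroupOfForm (starRingEnd ℂ) J)) := fun k hk => by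
    rw [← SetLike.mem_coe, hK₁def] at hk
    obtain ⟨s, hs⟩ := hk
    exact ⟨s, hs.symm⟩
  have hK₁ : IsCompact (K₁ : Set ↥(unitaryGroupOfForm (starRingEnd ℂ) J)) := by rw [hK₁def]; exact isCompact_range_rotLift hJ
  have hKB : ∀ g : ↥(unitaryGroupOfForm (starRingEnd ℂ) J), ∃ k ∈ K₁, ∃ b ∈ borelU (starRingEnd ℂ) J, g = k * b := by
    intro g
    obtain ⟨s, b, hb, hg⟩ := exists_rotLift_mul_mem_borelU hJ g
    exact ⟨_, hKmem s, b, hb, hg⟩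
  haveI : CompactSpace ↥K₁ := isCompact_iff_compactSpace.1 hK₁
  haveI : BorelSpace ↥K₁ := Subtype.borelSpace _
  obtain ⟨κ, hκ⟩ : ∃ κ : Measure ↥K₁, IsHaarMeasure κ := ⟨_, isHaarMeasure_map_rotLift hJ K₁ hKmem hKmem'⟩
  haveI := hκ
  obtain ⟨μN, hμN⟩ : ∃ μN : Measure ↥(unipotentU (starRingEnd ℂ) J), IsHaarMeasure μN := ⟨Measure.haar, inferInstance⟩
  haveI := hμN
  obtain ⟨C', hC'0, hμC⟩ := exists_measure_quotient_torusU_complex_two_eq_smul_map hJ hK₁ hKB κ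
    (Measure.haar : Measure ↥(torusU (starRingEnd ℂ) J)) μN μ₀' hμ0
  -- the split-frame Casimir and (B-r1): ONE `κ₀` for all test functions
  obtain ⟨κ₀, -, hBr1⟩ := exists_hasOneSidedJump_iteratedDeriv_allOrders_chart_of_eq_over L w hJ μ₀ κ μN hK₁ hKB _ (fun _ _ => rfl)
  -- the two readers (centre `e^{i0} = 1`, i.e. (B-r1)'s tokens at `θ = 0`)
  obtain ⟨Φ₁, hΦ₁⟩ : ∃ Φ₁ : (Matrix (Fin 2) (Fin 2) ℂ → ℂ) → ℝ → ℂ, ∀ (F : Matrix (Fin 2) (Fin 2) ℂ → ℂ) (ψ : ℝ), Φ₁ F ψ = (2 * Real.sin ψ : ℂ) *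
      ∫ h : ↥(unitaryGroupOfForm (starRingEnd ℂ) J), F (((h * (⟨(Matrix.GeneralLinearGroup.mkOfDetNeZero !![(1 : ℂ), 1; 1, -1] det_cayleyTwo_ne_zero) * circleDiagonal 2 ![Circle.exp 0 * Circle.exp ψ, Circle.exp 0 * Circle.exp (-ψ)] * ((Matrix.GeneralLinearGroup.mkOfDetNeZero !![(1 : ℂ), 1; 1, -1] det_cayleyTwo_ne_zero))⁻¹,
            cayley_conj_circleDiagonal_mem_of_eq_over hJ _⟩ : ↥(unitaryGroupOfForm (starRingEnd ℂ) J)) * h⁻¹ : ↥(unitaryGroupOfForm (starRingEnd ℂ) J)) : GL (Fin 2) ℂ) : Matrix (Fin 2) (Fin 2) ℂ) ∂μ₀ := ⟨fun F ψ => _, fun _ _ => rfl⟩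
  obtain ⟨Φ₂, hΦ₂⟩ : ∃ Φ₂ : (Matrix (Fin 2) (Fin 2) ℂ → ℂ) → ℝ → ℂ, ∀ (F : Matrix (Fin 2) (Fin 2) ℂ → ℂ) (x : ℝ), Φ₂ F x =
      ∫ p : ↥K₁ × ↥(unipotentU (starRingEnd ℂ) J), F ((((((p.1 : ↥K₁) : ↥(unitaryGroupOfForm (starRingEnd ℂ) J)) * ((⟨hypBlockGL 0 0, hypBlockGL_mem_of_eq_over hJ 0 0⟩ : ↥(unitaryGroupOfForm (starRingEnd ℂ) J)) * (⟨hypBlockGL (x / 2) 0, hypBlockGL_mem_of_eq_over hJ (x / 2) 0⟩ : ↥(unitaryGroupOfForm (starRingEnd ℂ) J)) * ((p.2 : ↥(unipotentU (starRingEnd ℂ) J)) : ↥(unitaryGroupOfForm (starRingEnd ℂ) J)) * (⟨hypBlockGL (x / 2) 0, hypBlockGL_mem_of_eq_over hJ (x / 2) 0⟩ : ↥(unitaryGroupOfForm (starRingEnd ℂ) J))) * ((p.1 : ↥K₁) : ↥(unitaryGroupOfForm (starRingEnd ℂ) J))⁻¹ : ↥(unitaryGroupOfForm (starRingEnd ℂ)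 J))) : GL (Fin 2) ℂ) : Matrix (Fin 2) (Fin 2) ℂ) ∂(κ.prod μN) := ⟨fun F x => _, fun _ _ => rfl⟩
  have hΦ₁' : ∀ (F : Matrix (Fin 2) (Fin 2) ℂ → ℂ) (ψ : ℝ), Φ₁ F ψ = (2 * Real.sin ψ) •
      ∫ h : ↥(unitaryGroupOfForm (starRingEnd ℂ) J), F (((h * (⟨(Matrix.GeneralLinearGroup.mkOfDetNeZero !![(1 : ℂ), 1; 1, -1] det_cayleyTwo_ne_zero) * circleDiagonal 2 ![Circle.exp 0 * Circle.exp ψ, Circle.exp 0 * Circle.exp (-ψ)] * ((Matrix.GeneralLinearGroup.mkOfDetNeZero !![(1 : ℂ), 1; 1, -1] det_cayleyTwo_ne_zero))⁻¹,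
            cayley_conj_circleDiagonal_mem_of_eq_over hJ _⟩ : ↥(unitaryGroupOfForm (starRingEnd ℂ) J)) * h⁻¹ : ↥(unitaryGroupOfForm (starRingEnd ℂ) J)) : GL (Fin 2) ℂ) : Matrix (Fin 2) (Fin 2) ℂ) ∂μ₀ := fun F ψ => by
    rw [hΦ₁, Complex.real_smul, Complex.ofReal_mul, Complex.ofReal_ofNat]
  -- the admissible families and the parameter derivative
  obtain ⟨Adm, hAdm⟩ : ∃ Adm : (({w : InfinitePlace L // IsComplex w} → Fin 3 → ℝ) → Matrix (Fin 2) (Fin 2) ℂ → ℂ) → Prop, ∀ g, Adm g ↔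
      (ContDiff ℝ ∞ (Function.uncurry g) ∧ ∃ C : Set (Matrix (Fin 2) (Fin 2) ℂ), IsCompact C ∧ ∀ (q : {w : InfinitePlace L // IsComplex w} → Fin 3 → ℝ) (X : Matrix (Fin 2) (Fin 2) ℂ), X ∉ C → g q X = 0) := ⟨_, fun _ => Iff.rfl⟩
  obtain ⟨D, hD⟩ : ∃ D : ({w : InfinitePlace L // IsComplex w} → Fin 3 → ℝ) → (({w : InfinitePlace L // IsComplex w} → Fin 3 → ℝ) → Matrix (Fin 2) (Fin 2) ℂ → ℂ) → (({w : InfinitePlace L // IsComplex w} → Fin 3 → ℝ) → Matrix (Fin 2) (Fin 2) ℂ → ℂ),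
      ∀ v g, D v g = fun q X => fderiv ℝ (fun q' => g q' X) q v := ⟨_, fun _ _ => rfl⟩
  have hcl : ∀ g, Adm g → ∀ v, Adm (D v g) := by
    intro g hg v
    obtain ⟨h1, C, hC, h0⟩ := (hAdm g).1 hg
    rw [hD]
    exact (hAdm _).2 ⟨contDiff_uncurry_fderiv_apply h1 v, C, hC, forall_fderiv_apply_eq_zero_of_support h0 v⟩
  -- (H1)(H2) for both readers
  have hT₁ : IsOpen {ψ : ℝ | Real.sin ψ ≠ 0} := isOpen_ne_fun Real.continuous_sin continuous_const
  have hrayT : ∀ᶠ t : ℝ in 𝓝[≠] 0, t ∈ {ψ : ℝ | Real.sin ψ ≠ 0} := by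
    have hI : Set.Ioo (-Real.pi) Real.pi ∈ 𝓝 (0 : ℝ) := Ioo_mem_nhds (neg_lt_zero.2 Real.pi_pos) Real.pi_pos
    filter_upwards [mem_nhdsWithin_of_mem_nhds hI, self_mem_nhdsWithin] with t ht ht0
    intro hsin
    exact ht0 ((Real.sin_eq_zero_iff_of_lt_of_lt ht.1 ht.2).1 hsin)
  -- the jump for EVERY admissible family, ONE `κ₀`
  have hjumpAll : ∀ (p : {w : InfinitePlace L // IsComplex w} → Fin 3 → ℝ) (g' : ({w : InfinitePlace L // IsComplex w} → Fin 3 → ℝ) → Matrix (Fin 2) (Fin 2) ℂ → ℂ), Adm g' → ∀ a : ℕ,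
      HasOneSidedJump (fun t : ℝ => iteratedDeriv a (Φ₁ (g' p)) t) ((κ₀ : ℂ) * I ^ a * iteratedDeriv a (Φ₂ (g' p)) 0) := by
    intro p g' hg' a
    obtain ⟨h1, C, hC, h0⟩ := (hAdm g').1 hg'
    have hs : ContDiff ℝ ∞ (g' p) := h1.comp (contDiff_const.prodMk contDiff_id)
    have hcs : HasCompactSupport (g' p) := HasCompactSupport.intro hC (fun X hX => h0 p X hX)
    exact hBr1 (g' p) hs hcs 0 Φ₁ hΦ₁ Φ₂ hΦ₂ a
  -- the constant
  refine ⟨I * (κ₀ : ℂ) / ((C' : ℝ) : ℂ), fun a' ha' p hp n m => ?_⟩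
  -- (B-desc-hyp): ONE `K`, ONE block family `f`, the smooth split token `G`
  obtain ⟨K, U, U'', f, G, hK, hU, hpU, hU'', hpU'', -, hf, ⟨C, hC, hfC⟩, htan, hcpt, -, hG, hGtoken, hEqOn, -⟩ :=
    exists_twoChart_descent_orbFamGExt_realWall L α ν' hα hreal hJ μ₀ μ₀' hlink hS' hw hwsp hp ha'
  -- the split token in `K × N` currency, through `x = 0`
  have hGΛ : ∀ (q : {w : InfinitePlace L // IsComplex w} → Fin 3 → ℝ) (x θ : ℝ), G (q, x, θ) = (C' : ℝ) • ∫ p : ↥K₁ × ↥(unipotentU (starRingEnd ℂ) J), f (q, ((((((p.1 : ↥K₁) : ↥(unitaryGroupOfForm (starRingEnd ℂ) J)) * ((⟨hypBlockGL 0 θ, hypBlockGL_mem_of_eq_over hJ 0 θ⟩ : ↥(unitaryGroupOfForm (starRingEnd ℂ) J)) * (⟨hypBlockGL (x / 2) 0, hypBlockGL_mem_of_eq_over hJ (x / 2) 0⟩ : ↥(unitaryGroupOfForm (starRingEnd ℂ) J)) * ((p.2 : ↥(unipotentU (starRingEnd ℂ) J)) : ↥(unitaryGroupOfForm (starRingEnd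 ℂ) J)) * (⟨hypBlockGL (x / 2) 0, hypBlockGL_mem_of_eq_over hJ (x / 2) 0⟩ : ↥(unitaryGroupOfForm (starRingEnd ℂ) J))) * ((p.1 : ↥K₁) : ↥(unitaryGroupOfForm (starRingEnd ℂ) J))⁻¹ : ↥(unitaryGroupOfForm (starRingEnd ℂ) J))) : GL (Fin 2) ℂ) : Matrix (Fin 2) (Fin 2) ℂ)) ∂(κ.prod μN) :=
    fun q x θ => eq_smul_integral_prod_of_splitToken hJ κ μN μ₀' hK₁ hμC f hf.continuous hC hfC G hG.continuous hGtoken q x θ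
  -- the centre-absorbed family
  have hcoord : ∀ (w' : {w : InfinitePlace L // IsComplex w}) (l : Fin 3), ContDiff ℝ ∞ fun q : {w : InfinitePlace L // IsComplex w} → Fin 3 → ℝ => q w' l := fun w' l => contDiff_apply_apply (𝕜 := ℝ) (E := ℝ) w' l
  have hzc : ContDiff ℝ ∞ fun q : {w : InfinitePlace L // IsComplex w} → Fin 3 → ℝ => ((Circle.exp ((q w 0 + q w 2) / 2) : Circle) : ℂ) :=
    contDiff_coe_circleExp_comp_of_contDiff (((hcoord w 0).add (hcoord w 2)).div_const 2)
  -- the cofactor carrier `Q` and the frozen cofactors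
  have hQ : IsOpen {q : {w : InfinitePlace L // IsComplex w} → Fin 3 → ℝ | ∀ w' ∈ S', w' ≠ w → q w' 0 ≠ 0} := isOpen_setOf_forall_mem_apply_ne_zero S' w
  have hpQ : p ∈ {q : {w : InfinitePlace L // IsComplex w} → Fin 3 → ℝ | ∀ w' ∈ S', w' ≠ w → q w' 0 ≠ 0} := fun w' hw' _ => hp.2.2.2 w' hw'
  -- the regular neighbourhoods
  obtain ⟨U₀, hU₀, hpU₀, -, hU₀1, hU₀2, hU₀3, hU₀4⟩ := exists_nhds_hcSemireg hw (show (0 : Fin 3) ≠ 2 by decide) hp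
  have hU₂ : IsOpen (U'' ∩ InRegG (slotSign L α) (insert w S')) := hU''.inter (isOpen_inRegG _ _)
  have hpU₂ : hcCayPt w 0 2 p ∈ U'' ∩ InRegG (slotSign L α) (insert w S') := ⟨hpU'', hcCayPt_mem_inRegG_insert (slotSign L α) hp⟩
  -- the atoms of ★ (B-trans): family, cofactors, Wick pair, the two genuine families
  obtain ⟨g, hgdef⟩ : ∃ g : ({w : InfinitePlace L // IsComplex w} → Fin 3 → ℝ) → Matrix (Fin 2) (Fin 2) ℂ → ℂ,
      g = fun (q : {w : InfinitePlace L // IsComplex w} → Fin 3 → ℝ) (X : Matrix (Fin 2) (Fin 2) ℂ) => f (q, ((Circle.exp ((q w 0 + q w 2) / 2) : Circle) : ℂ) • X) := ⟨_, rfl⟩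
  have hg : Adm g := by
    rw [hgdef]
    exact (hAdm _).2 ⟨contDiff_uncurry_centreAbsorb f hf _ hzc, exists_isCompact_forall_centreAbsorb_eq_zero f hC hfC (fun q => Circle.exp ((q w 0 + q w 2) / 2))⟩
  obtain ⟨Pf, hPf⟩ : ∃ Pf : ({w : InfinitePlace L // IsComplex w} → Fin 3 → ℝ) → ℂ, Pf = fun q : {w : InfinitePlace L // IsComplex w} → Fin 3 → ℝ => (∏ w' ∈ Finset.univ.erase w,
            ((if w' ∈ S' then (1 : ℂ) else (Circle.exp (q w' 0 - q w' 2) : ℂ)) *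
              (if w' ∈ S' then
                  ((|Real.exp (q w' 0) - Real.exp (-q w' 0)| *
                    ‖cexp (q w' 0 + q w' 2 * I) - cexp (q w' 1 * I)‖ * ‖cexp (-q w' 0 + q w' 2 * I) - cexp (q w' 1 * I)‖ : ℝ) : ℂ)
                else (1 - (Circle.exp (q w' 1 - q w' 0) : ℂ)) * (1 - (Circle.exp (q w' 2 - q w' 0) : ℂ)) * (1 - (Circle.exp (q w' 2 - q w' 1) : ℂ))))) := ⟨_, rfl⟩
  obtain ⟨Ef, hEf⟩ : ∃ Ef : ({w : InfinitePlace L // IsComplex w} → Fin 3 → ℝ) → ℂ, Ef = fun q : {w : InfinitePlace L // IsComplex w} → Fin 3 → ℝ =>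
      (((2 * Real.cos (q w 0 - q w 1) - 2 * Real.cos 0 : ℝ)) : ℂ) * (∏ w' ∈ Finset.univ.erase w,
            ((if w' ∈ S' then (1 : ℂ) else (Circle.exp (q w' 0 - q w' 2) : ℂ)) *
              (if w' ∈ S' then
                  ((|Real.exp (q w' 0) - Real.exp (-q w' 0)| *
                    ‖cexp (q w' 0 + q w' 2 * I) - cexp (q w' 1 * I)‖ * ‖cexp (-q w' 0 + q w' 2 * I) - cexp (q w' 1 * I)‖ : ℝ) : ℂ)
                else (1 - (Circle.exp (q w' 1 - q w' 0) : ℂ)) * (1 - (Circle.exp (q w' 2 - q w' 0) : ℂ)) * (1 - (Circle.exp (q w' 2 - q w' 1) : ℂ))))) := ⟨_, rfl⟩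
  have hPfs : ContDiffOn ℝ ∞ Pf {q : {w : InfinitePlace L // IsComplex w} → Fin 3 → ℝ | ∀ w' ∈ S', w' ≠ w → q w' 0 ≠ 0} := by rw [hPf]; exact contDiffOn_frozenProd S' w
  have hEfs : ContDiffOn ℝ ∞ Ef {q : {w : InfinitePlace L // IsComplex w} → Fin 3 → ℝ | ∀ w' ∈ S', w' ≠ w → q w' 0 ≠ 0} := by rw [hEf]; exact contDiffOn_twoCosSub_mul_frozenProd S' w 0
  obtain ⟨ce, hce⟩ : ∃ ce : ℝ → ℂ, ce = fun t : ℝ => (((2 * Real.cos t - 2 * Real.cos 0 : ℝ)) : ℂ) := ⟨_, rfl⟩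
  obtain ⟨ch, hch⟩ : ∃ ch : ℝ → ℂ, ch = fun x : ℝ => (((2 * Real.cosh x - 2 * Real.cos 0 : ℝ)) : ℂ) := ⟨_, rfl⟩
  have hces : ContDiff ℝ ∞ ce := by rw [hce]; exact contDiff_ofReal_two_cos_sub 0
  have hchs : ContDiff ℝ ∞ ch := by rw [hch]; exact contDiff_ofReal_two_cosh_sub 0
  have hwick : ∀ a : ℕ, iteratedDeriv a ce 0 = I ^ a * iteratedDeriv a ch 0 := by
    intro a; rw [hce, hch]; exact iteratedDeriv_ofReal_two_cos_sub_zero_eq_I_pow_mul 0 a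
  obtain ⟨F₁, hF₁⟩ : ∃ F₁ : ({w : InfinitePlace L // IsComplex w} → Fin 3 → ℝ) → ℂ, F₁ = fun c => archERhoG S' c * orbFamGExt L α ν' a' S' c := ⟨_, rfl⟩
  obtain ⟨F₂, hF₂⟩ : ∃ F₂ : ({w : InfinitePlace L // IsComplex w} → Fin 3 → ℝ) → ℂ, F₂ = fun c => archERhoG (insert w S') c * orbFamGExt L α ν' a' (insert w S') c := ⟨_, rfl⟩
  -- (H1)(H2) for both readers
  have h11 : ∀ g', Adm g' → ContDiffOn ℝ ∞ (fun z : ({w : InfinitePlace L // IsComplex w} → Fin 3 → ℝ) × ℝ => Φ₁ (g' z.1) z.2)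
      ({q : {w : InfinitePlace L // IsComplex w} → Fin 3 → ℝ | ∀ w' ∈ S', w' ≠ w → q w' 0 ≠ 0} ×ˢ {ψ : ℝ | Real.sin ψ ≠ 0}) := by
    intro g' hg'
    obtain ⟨h1, h2⟩ := (hAdm g').1 hg'
    exact (contDiffOn_cayley_orbitalIntegral_param hJ μ₀ (Circle.exp 0) Φ₁ hΦ₁' g' h1 h2).mono (Set.prod_mono (Set.subset_univ _) le_rfl)
  have h21 : ∀ g', Adm g' → ∀ (v : {w : InfinitePlace L // IsComplex w} → Fin 3 → ℝ) (z : ({w : InfinitePlace L // IsComplex w} → Fin 3 → ℝ) × ℝ),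
      z ∈ {q : {w : InfinitePlace L // IsComplex w} → Fin 3 → ℝ | ∀ w' ∈ S', w' ≠ w → q w' 0 ≠ 0} ×ˢ {ψ : ℝ | Real.sin ψ ≠ 0} →
        fderiv ℝ (fun z : ({w : InfinitePlace L // IsComplex w} → Fin 3 → ℝ) × ℝ => Φ₁ (g' z.1) z.2) z (v, 0) = Φ₁ (D v g' z.1) z.2 := by
    intro g' hg' v z hz
    obtain ⟨h1, h2⟩ := (hAdm g').1 hg'
    rw [hD]
    exact fderiv_cayley_orbitalIntegral_param_prod_apply hJ μ₀ (Circle.exp 0) Φ₁ hΦ₁' g' h1 h2 v hz.2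
  have h12 : ∀ g', Adm g' → ContDiffOn ℝ ∞ (fun z : ({w : InfinitePlace L // IsComplex w} → Fin 3 → ℝ) × ℝ => Φ₂ (g' z.1) z.2)
      ({q : {w : InfinitePlace L // IsComplex w} → Fin 3 → ℝ | ∀ w' ∈ S', w' ≠ w → q w' 0 ≠ 0} ×ˢ (univ : Set ℝ)) := by
    intro g' hg'
    obtain ⟨h1, h2⟩ := (hAdm g').1 hg'
    exact (contDiff_splitIntegral_param hJ κ μN hK₁ 0 Φ₂ hΦ₂ g' h1 h2).contDiffOn
  have h22 : ∀ g', Adm g' → ∀ (v : {w : InfinitePlace L // IsComplex w} → Fin 3 → ℝ) (z : ({w : InfinitePlace L // IsComplex w} → Fin 3 → ℝ) × ℝ),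
      z ∈ {q : {w : InfinitePlace L // IsComplex w} → Fin 3 → ℝ | ∀ w' ∈ S', w' ≠ w → q w' 0 ≠ 0} ×ˢ (univ : Set ℝ) →
        fderiv ℝ (fun z : ({w : InfinitePlace L // IsComplex w} → Fin 3 → ℝ) × ℝ => Φ₂ (g' z.1) z.2) z (v, 0) = Φ₂ (D v g' z.1) z.2 := by
    intro g' hg' v z _
    obtain ⟨h1, h2⟩ := (hAdm g').1 hg'
    rw [hD]
    exact fderiv_splitIntegral_param_prod_apply hJ κ μN hK₁ 0 Φ₂ hΦ₂ g' h1 h2 v z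
  -- the two dresses (PART 1)
  have hdesc₁ : ∀ c ∈ U ∩ U₀, ((c w 0 - c w 2) / 2) ∈ {ψ : ℝ | Real.sin ψ ≠ 0} →
      F₁ c = (K * I) * (ce ((c w 0 - c w 2) / 2) * Pf (c - ((c w 0 - c w 2) / 2) • hcNrm w 0 2) - Ef (c - ((c w 0 - c w 2) / 2) • hcNrm w 0 2)) * Φ₁ (g (c - ((c w 0 - c w 2) / 2) • hcNrm w 0 2)) ((c w 0 - c w 2) / 2) := by
    intro c hc hνT
    have hne : c w 0 ≠ c w 2 := by
      intro h
      apply hνT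
      show Real.sin ((c w 0 - c w 2) / 2) = 0
      rw [h, sub_self, zero_div, Real.sin_zero]
    have hcreg : c ∈ RegG S' := mem_regG_of_offWall (show (0 : Fin 3) ≠ 2 by decide) (hU₀1 c hc.2) (hU₀2 c hc.2) (hU₀3 c hc.2) (hU₀4 c hc.2) hne
    rw [hF₁, hce, hPf, hEf, hΦ₁, hgdef]
    exact archERhoG_mul_orbFamGExt_eq_compactReader L α ν' a' hJ μ₀ hS' hw htan hcpt 0 hc.1 hcreg
  have hdesc₂ : ∀ c ∈ U'' ∩ InRegG (slotSign L α) (insert w S'),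
      F₂ c = (K * ((C' : ℝ) : ℂ)) * (ch (c w 0) * Pf (Function.update c w (fun s => if s = hcThird 0 2 then c w 1 else c w 2)) - Ef (Function.update c w (fun s => if s = hcThird 0 2 then c w 1 else c w 2))) * Φ₂ (g (Function.update c w (fun s => if s = hcThird 0 2 then c w 1 else c w 2))) (c w 0) := by
    intro c hc
    rw [hF₂, hch, hPf, hEf, hΦ₂, hgdef]
    exact archERhoG_mul_orbFamGExt_eq_splitReader L α ν' a' hJ κ μN S' w htan hGΛ 0 (hEqOn hc)
  have hK₂ : K * ((C' : ℝ) : ℂ) ≠ 0 := mul_ne_zero hK (by exact_mod_cast (NNReal.coe_ne_zero.2 hC'0))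
  -- ★ (B-trans)
  have key := hasOneSidedJump_iteratedFDeriv_adaptedWord_of_twoChart w (show (0 : Fin 3) ≠ 2 by decide) Φ₁ Φ₂ hT₁ hrayT Adm D hcl hQ
    h11 h21 h12 h22 g hg Pf Ef hPfs hEfs ce ch hces hchs hwick (K * I) (K * ((C' : ℝ) : ℂ)) (κ₀ : ℂ) hK₂ hp.1 hpQ F₁ F₂
    (hU.inter hU₀) ⟨hpU, hpU₀⟩ hU₂ hpU₂ hdesc₁ hdesc₂ (hjumpAll p) n m
  have hconst : K * I / (K * ((C' : ℝ) : ℂ)) * (κ₀ : ℂ) = I * (κ₀ : ℂ) / ((C' : ℝ) : ℂ) := by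
    rw [mul_div_mul_left _ _ hK]; ring
  rw [hconst, hF₁, hF₂] at key
  simp only [hcTwistedDeriv]
  exact key

end MainW02

/-! ## §2 (B-asm) in the nondegenerate frame: guards + relabel, `jc′` universality, assembly with (I₁) -/

section Assembly

variable (L : Type) [Field L] [NumberField L] [IsCMField L] (α : Fin 3 → L)
  [MeasurableSpace ↥(arch (↥(maximalRealSubfield L)) L (IsCMField.complexConj L) 3 (Matrix.diagonal α))] [BorelSpace ↥(arch (↥(maximalRealSubfield L)) L (IsCMField.complexConj L) 3 (Matrix.diagonal α))]
  (ν' : Measure ↥(arch (↥(maximalRealSubfield L)) L (IsCMField.complexConj L) 3 (Matrix.diagonal α))) [ν'.IsHaarMeasure] [ν'.IsMulRightInvariant]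

/-- **L1 frame form — NONDEGENERATE-FRAME TWIN of ★ `archHcJump_orbFamGExt_of_wall02`** (`Literature/NumberTheory/Rogawski1990/ArchOrbFamGExtJump.lean`): the same statement with the anisotropy binder `hanis` replaced by
`hα : ∀ i, α i ≠ 0`; proof = the ★ body verbatim (the line `have hα := ne_zero_of_diagonal_anisotropic hanis` deleted). [cite: Shelstad1979, Prop. 4.5 (p. 26); Thm. 4.7 (p. 31)] [cite: Bouaziz1994IntegralesOrbitales, §3.2 (I₃) p. 580] [cite: Varadarajan1977, I §1.12] -/
theorem archHcJump_orbFamGExt_of_wall02_of_ne_zero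
    (hherm : ((Matrix.diagonal α).map (cmConjRingHom L)).transpose = Matrix.diagonal α)
    (hα : ∀ i, α i ≠ 0)
    {a' : ↥(arch (↥(maximalRealSubfield L)) L (IsCMField.complexConj L) 3 (Matrix.diagonal α)) → ℂ}
    (J : Finset {w : InfinitePlace L // IsComplex w} → {w : InfinitePlace L // IsComplex w} → ℂ)
    (h02 : ∀ S' : Finset {w : InfinitePlace L // IsComplex w}, (∀ w, w ∈ S' → w ∈ splitChartPlaces L α) →
      ∀ w : {w : InfinitePlace L // IsComplex w}, w ∉ S' → w ∈ splitChartPlaces L α →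
        ∀ p : {w : InfinitePlace L // IsComplex w} → Fin 3 → ℝ, HcSemireg S' w 0 2 p → ∀ (n : ℕ) (m : Fin n → {w : InfinitePlace L // IsComplex w} × Fin 3),
          HasOneSidedJump
            (fun ν : ℝ => hcTwistedDeriv S' n (fun r => hcAdaptedVec w 0 2 (m r)) (orbFamGExt L α ν' a' S') (p + ν • hcNrm w 0 2))
            (J S' w * hcCayScalar w 0 m * hcTwistedDeriv (insert w S') n (fun r => hcCayVec w 0 2 (m r)) (orbFamGExt L α ν' a' (insert w S')) (hcCayPt w 0 2 p))) :
    ArchHcJump (slotSign L α)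
      (fun S' w i j => if (∀ v, v ∈ S' → v ∈ splitChartPlaces L α) ∧ w ∈ splitChartPlaces L α then
        (if i = 0 ∧ j = 2 ∨ i = 2 ∧ j = 1 then 1 else if i = 2 ∧ j = 0 ∨ i = 1 ∧ j = 2 then -1 else 0 : ℂ) * J S' w else 0)
      (orbFamGExt L α ν' a') := by
  have hreal : ∀ (w : {w : InfinitePlace L // IsComplex w}) (i : Fin 3), (w.1.embedding (α i)).im = 0 :=
    fun w i => im_embedding_diagonal_eq_zero L 3 α (complexConj_apply_eq_of_diagonal_frame hherm) w i
  intro S' w hw i j hij hsij p hp n m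
  by_cases hadm : ∀ v, v ∈ S' → v ∈ splitChartPlaces L α
  swap
  · -- a non-admissible chart: both members vanish identically
    have hadm' : ¬ ∀ v, v ∈ insert w S' → v ∈ splitChartPlaces L α :=
      fun h => hadm fun v hv => h v (Finset.mem_insert_of_mem hv)
    rw [orbFamGExt_of_not_admissible L α ν' a' S' hadm, orbFamGExt_of_not_admissible L α ν' a' (insert w S') hadm']
    refine ⟨0, 0, ?_, ?_, ?_⟩
    · simp only [hcTwistedDeriv_fun_zero]; exact tendsto_const_nhds
    · simp only [hcTwistedDeriv_fun_zero]; exact tendsto_const_nhds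
    · rw [hcTwistedDeriv_fun_zero, mul_zero, sub_zero]
  -- an admissible chart; `w` is indefinite for `diag α`, hence a split-chart place, and `slotSign w 0 = slotSign w 1 ≠ slotSign w 2`
  have hind : ¬ (formSign L α w 0 = formSign L α w 1 ∧ formSign L α w 1 = formSign L α w 2) := by
    rintro ⟨h01, h12⟩
    have hall : ∀ k : Fin 3, formSign L α w k = formSign L α w 0 := by
      intro k
      fin_cases k
      · rfl
      · exact h01.symm
      · exact h12.symm.trans h01.symm
    apply hsij
    rw [slotSign_apply, slotSign_apply, hall (lineOf (formSign L α w) i), hall (lineOf (formSign L α w) j)]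
  have hwsp : w ∈ splitChartPlaces L α := mem_splitChartPlaces_of_frame hα (hreal w) hind
  obtain ⟨h10, -, -⟩ := slotSign_of_mem_splitChartPlaces L α hα hwsp
  have hs01 : slotSign L α w 0 = slotSign L α w 1 := h10.symm
  have hW : ArchHcWeyl (slotSign L α) (orbFamGExt L α ν' a') := archHcWeyl_orbFamGExt L α ν' hα hreal a'
  -- (W): the split member is even in `x_w`; the twisted compact member flips under the realised reflection `(0 1)` on `RegG S′`
  have heven : ∀ c, orbFamGExt L α ν' a' (insert w S') (negXAt w c) = orbFamGExt L α ν' a' (insert w S') c :=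
    fun c => hW.2 (insert w S') c w (Finset.mem_insert_self w S')
  have hflip : ∀ c ∈ RegG S', archERhoG S' (hcSwapAt w 0 1 c) * orbFamGExt L α ν' a' S' (hcSwapAt w 0 1 c) = -(archERhoG S' c * orbFamGExt L α ν' a' S' c) := by
    intro c hc
    have h := archERhoG_mul_eq_neg_hcSwapAt_of_archHcWeyl hW hw hs01 (c := hcSwapAt w 0 1 c) (by rwa [hcSwapAt_hcSwapAt])
    rwa [hcSwapAt_hcSwapAt] at h
  -- the clause at the four noncompact pairs
  have H02 := h02 S' hadm w hw hwsp
  have H20 := archHcJump_clause_pair_swap (show (0 : Fin 3) ≠ 2 by decide) heven H02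
  have H12 := archHcJump_clause_slot_swap hw (show (0 : Fin 3) ≠ 2 by decide) (show (0 : Fin 3) ≠ 1 by decide) (show (2 : Fin 3) ≠ 1 by decide) hflip H02
  have H21 := archHcJump_clause_pair_swap (show (1 : Fin 3) ≠ 2 by decide) heven H12
  simp only [if_pos (show (∀ v, v ∈ S' → v ∈ splitChartPlaces L α) ∧ w ∈ splitChartPlaces L α from ⟨hadm, hwsp⟩)]
  rcases noncompactPair_cases hs01 hij hsij with ⟨rfl, rfl⟩ | ⟨rfl, rfl⟩ | ⟨rfl, rfl⟩ | ⟨rfl, rfl⟩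
  · rw [if_pos (by decide), one_mul]
    exact H02 p hp n m
  · rw [if_neg (by decide), if_pos (by decide), neg_one_mul]
    exact H20 p hp n m
  · rw [if_neg (by decide), if_pos (by decide), neg_one_mul]
    exact H12 p hp n m
  · rw [if_pos (by decide), one_mul]
    have h := H21 p hp n m
    rw [neg_neg] at h
    exact h

/-- **L1 frame form — NONDEGENERATE-FRAME TWIN of ★ `exists_archHcJump_orbFamGExt`** (`Literature/NumberTheory/Rogawski1990/ArchOrbFamGExtJump.lean`): the same statement with the anisotropy binder `hanis` replaced by
`hα : ∀ i, α i ≠ 0`; proof = the ★ body verbatim (the line `have hα := ne_zero_of_diagonal_anisotropic hanis` deleted). [cite: Varadarajan1977, I §1.12] [cite: Shelstad1979, Thm. 4.7 (p. 31)] [cite: Bouaziz1994IntegralesOrbitales, §3.2 (I₃) p. 580] -/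
theorem exists_archHcJump_orbFamGExt_of_ne_zero
    (hherm : ((Matrix.diagonal α).map (cmConjRingHom L)).transpose = Matrix.diagonal α)
    (hα : ∀ i, α i ≠ 0)
    (h02 : ∀ S' : Finset {w : InfinitePlace L // IsComplex w}, (∀ w, w ∈ S' → w ∈ splitChartPlaces L α) →
      ∀ w : {w : InfinitePlace L // IsComplex w}, w ∉ S' → w ∈ splitChartPlaces L α →
        ∃ J : ℂ, ∀ a' : ↥(arch (↥(maximalRealSubfield L)) L (IsCMField.complexConj L) 3 (Matrix.diagonal α)) → ℂ, ArchSmooth L 3 (Matrix.diagonal α) a' →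
          ∀ p : {w : InfinitePlace L // IsComplex w} → Fin 3 → ℝ, HcSemireg S' w 0 2 p → ∀ (n : ℕ) (m : Fin n → {w : InfinitePlace L // IsComplex w} × Fin 3),
            HasOneSidedJump
              (fun ν : ℝ => hcTwistedDeriv S' n (fun r => hcAdaptedVec w 0 2 (m r)) (orbFamGExt L α ν' a' S') (p + ν • hcNrm w 0 2))
              (J * hcCayScalar w 0 m * hcTwistedDeriv (insert w S') n (fun r => hcCayVec w 0 2 (m r)) (orbFamGExt L α ν' a' (insert w S')) (hcCayPt w 0 2 p))) :
    ∃ jc' : Finset {w : InfinitePlace L // IsComplex w} → {w : InfinitePlace L // IsComplex w} → Fin 3 → Fin 3 → ℂ,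
      ∀ a' : ↥(arch (↥(maximalRealSubfield L)) L (IsCMField.complexConj L) 3 (Matrix.diagonal α)) → ℂ, ArchSmooth L 3 (Matrix.diagonal α) a' →
        ArchHcJump (slotSign L α) jc' (orbFamGExt L α ν' a') := by
  -- choose the wall constants (before the test function)
  choose J hJ using h02
  -- `jc′ S′ w i j = ε i j · J(S′, w)` on the admissible pairs `(S′, w)`, `0` elsewhere
  refine ⟨fun S' w i j => if (∀ v, v ∈ S' → v ∈ splitChartPlaces L α) ∧ w ∈ splitChartPlaces L α then
      (if i = 0 ∧ j = 2 ∨ i = 2 ∧ j = 1 then 1 else if i = 2 ∧ j = 0 ∨ i = 1 ∧ j = 2 then -1 else 0 : ℂ) *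
        (if h : (∀ v, v ∈ S' → v ∈ splitChartPlaces L α) ∧ w ∈ splitChartPlaces L α then (if hw : w ∉ S' then J S' h.1 w hw h.2 else 0) else 0)
      else 0, fun a' ha' => ?_⟩
  exact archHcJump_orbFamGExt_of_wall02_of_ne_zero L α ν' hherm hα
    (fun S' w => if h : (∀ v, v ∈ S' → v ∈ splitChartPlaces L α) ∧ w ∈ splitChartPlaces L α then (if hw : w ∉ S' then J S' h.1 w hw h.2 else 0) else 0)
    (fun S' hS w hw hsp p hp n m => HasOneSidedJump.jump_congr (hJ S' hS w hw hsp a' ha' p hp n m) (by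
      simp only [dif_pos (show (∀ v, v ∈ S' → v ∈ splitChartPlaces L α) ∧ w ∈ splitChartPlaces L α from ⟨hS, hsp⟩), dif_pos hw]))

/-- **L1 frame form — NONDEGENERATE-FRAME TWIN of ★ `exists_archHCSpaceG_orbFamGExt`** (`Literature/NumberTheory/Rogawski1990/ArchOrbFamGExtJump.lean`): the same statement with the anisotropy binder `hanis` replaced by
`hα : ∀ i, α i ≠ 0`; proof = the ★ body verbatim (the line `have hα := ne_zero_of_diagonal_anisotropic hanis` deleted). [cite: Varadarajan1977, I §1.12] [cite: Bouaziz1994IntegralesOrbitales, §3.2 p. 580; Thm. 3.2.1 p. 581] [cite: Shelstad1979, Thm. 4.7 (p. 31)] -/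
theorem exists_archHCSpaceG_orbFamGExt_of_ne_zero
    (hherm : ((Matrix.diagonal α).map (cmConjRingHom L)).transpose = Matrix.diagonal α)
    (hα : ∀ i, α i ≠ 0)
    (h1 : ∀ a' : ↥(arch (↥(maximalRealSubfield L)) L (IsCMField.complexConj L) 3 (Matrix.diagonal α)) → ℂ, ArchSmooth L 3 (Matrix.diagonal α) a' →
      ∀ S' : Finset {w : InfinitePlace L // IsComplex w}, ContDiffOn ℝ ∞ (orbFamGExt L α ν' a' S') (InRegG (slotSign L α) S') ∧
        ∀ (n : ℕ) (K : Set ({w : InfinitePlace L // IsComplex w} → Fin 3 → ℝ)), IsCompact K →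
          BddAbove ((fun c => ‖iteratedFDeriv ℝ n (orbFamGExt L α ν' a' S') c‖) '' (K ∩ InRegG (slotSign L α) S')))
    (h02 : ∀ S' : Finset {w : InfinitePlace L // IsComplex w}, (∀ w, w ∈ S' → w ∈ splitChartPlaces L α) →
      ∀ w : {w : InfinitePlace L // IsComplex w}, w ∉ S' → w ∈ splitChartPlaces L α →
        ∃ J : ℂ, ∀ a' : ↥(arch (↥(maximalRealSubfield L)) L (IsCMField.complexConj L) 3 (Matrix.diagonal α)) → ℂ, ArchSmooth L 3 (Matrix.diagonal α) a' →
          ∀ p : {w : InfinitePlace L // IsComplex w} → Fin 3 → ℝ, HcSemireg S' w 0 2 p → ∀ (n : ℕ) (m : Fin n → {w : InfinitePlace L // IsComplex w} × Fin 3),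
            HasOneSidedJump
              (fun ν : ℝ => hcTwistedDeriv S' n (fun r => hcAdaptedVec w 0 2 (m r)) (orbFamGExt L α ν' a' S') (p + ν • hcNrm w 0 2))
              (J * hcCayScalar w 0 m * hcTwistedDeriv (insert w S') n (fun r => hcCayVec w 0 2 (m r)) (orbFamGExt L α ν' a' (insert w S')) (hcCayPt w 0 2 p))) :
    ∃ jc' : Finset {w : InfinitePlace L // IsComplex w} → {w : InfinitePlace L // IsComplex w} → Fin 3 → Fin 3 → ℂ,
      ∀ a' : ↥(arch (↥(maximalRealSubfield L)) L (IsCMField.complexConj L) 3 (Matrix.diagonal α)) → ℂ, ArchSmooth L 3 (Matrix.diagonal α) a' →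
        ArchHCSpaceG (slotSign L α) jc' (orbFamGExt L α ν' a') := by
  have hreal : ∀ (w : {w : InfinitePlace L // IsComplex w}) (i : Fin 3), (w.1.embedding (α i)).im = 0 :=
    fun w i => im_embedding_diagonal_eq_zero L 3 α (complexConj_apply_eq_of_diagonal_frame hherm) w i
  obtain ⟨jc', hjc'⟩ := exists_archHcJump_orbFamGExt_of_ne_zero L α ν' hherm hα h02
  exact ⟨jc', fun a' ha' =>
    (archHCSpaceG_orbFamGExt_iff_smoothBounded_and_jump L α ν' hα hreal (ArchSmooth.hasCompactSupport L 3 (Matrix.diagonal α) ha') jc').2 ⟨h1 a' ha', hjc' a' ha'⟩⟩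

end Assembly

end Literature.NumberTheory.Rogawski1990

end

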